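import Mathlib.Analysis.MeanInequalitiesPow
import Mathlib.GroupTheory.GroupAction.CardCommute
import Mathlib.GroupTheory.PGroup
import Literature.Barriers.MatrixMultiplication.QuasirandomBarrierLieType
import Literature.RepresentationTheory.FiniteGroups.SLnMinimalCharacterDegree
import Literature.RepresentationTheory.FiniteGroups.NumberOfIrreducibles
import Literature.RepresentationTheory.FiniteGroups.SecondOrthogonality
import Literature.RepresentationTheory.FiniteGroups.GLnClassNumber
import Literature.RepresentationTheory.FiniteGroups.GLnClassNumberBound
import Literature.LinearAlgebra.Matrix.CardSpecialLinearGroup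
import Literature.Combinatorics.Additive.TPPGroupAlgebra
import HarnessLib

/-!
# Proof of BCGPU 2023, Cor. 3.4 for `SL(n, q)` and `PSL(n, q)`: discharge of the named fact
# `BCGPU2023_cor34_typeA` modulo a class-number bound for `GL_n(𝔽_q)`

Topic `Literature/Barriers/MatrixMultiplication`; sequel to `QuasirandomBarrierLieType.lean`, whose named
fact `BCGPU2023_cor34_typeA` (J. Blasiak, H. Cohn, J. A. Grochow, K. Pratt, C. Umans, *Matrix
multiplication via matrix groups*, ITCS 2023 = arXiv:2204.03826 [BlasiakCohnGrochowPrattUmans2023],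
Cor. 3.4 restricted to the type-`A` families: ONE `ε > 0` such that every TPP triple in every
`SL(n, F)` / `PSL(n, F)`, `n ≥ 2`, `F` finite, satisfies `(|S||T||U|)^{(2+ε)/3} ≤ ∑ᵢ dᵢ^{2+ε}`) is
proved here following the printed proof (held copy `paper:arxiv-2204.03826`, p. 6–7):

> "First, we deal with the case of groups of Lie type of bounded rank. Such groups `G` satisfy
> `n(G) ≥ Ω(|G|^δ)` for some constant `δ>0`, as one can check from the bounds given in
> [Landazuri–Seitz], and this condition suffices by Cor. 3.3. Now let `G` be a group of Lie type of
> rank `r` and dimension `d` over `𝔽_q`. Then `|G| = Θ(q^d)` … `n(G) ≥ Ω(q^r)` … Hence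
> `|S||T||U| ≤ |G|^{3/2}/√n(G) + |G| = O(q^{3d/2 − r/2})`. By [Fulman–Guralnick], there are `O(q^r)`
> conjugacy classes in `G`. If we denote the character degrees of `G` by `d₁, d₂, …` then `∑ᵢ dᵢ² =
> |G|` and by convexity, `∑ᵢ dᵢ^ω` is minimized (for fixed number of summands) if all `dᵢ` are equal.
> It follows that `∑ᵢ dᵢ^ω ≥ Ω(q^{r + ω(d−r)/2})`, and therefore Thm. 2.2 cannot yield an upper
> bound on `ω` better than `ω ≤ 3(r + log_q C)/r` … If `r` is large enough, then this bound cannot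
> approach `2`, and the case of bounded `r` was dealt with above."

The inputs of the printed proof and where they come from:
* `n(SL_n(q)) ≥ Ω(q^{n−1})` (Landazuri–Seitz 1974, Lemma 3.1): PROVED in the tree,
  `Literature.RepresentationTheory.FiniteGroups.SLn.le_charDegree_of_three_le` /
  `….SLn.card_le_two_mul_charDegree_add_one` (`SLnMinimalCharacterDegree.lean`); here
  `secondCharDegree_SL_ge` / `secondCharDegree_PSL_ge` (`n(G) ≥ q^{n−1}/4` for both families, the
  `PSL` case by inflation, the tree's `IsIrrChar.comp_quotientMk`).
* `O(q^r)` conjugacy classes (Fulman–Guralnick 2012): the proof below only needs a bound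
  `k(GL_n(q)) ≤ q^{2n}` — stated INLINE as the hypothesis of
  `BCGPU2023_cor34_typeA_of_classNumber_GL` (no new named fact) — transferred to `SL` and `PSL` by
  the elementary `k(H) ≤ [G : H] · k(G)` (commuting pairs, Mathlib `card_comm_eq_card_conjClasses_mul_card`;
  `card_conjClasses_subgroup_le`) and `k(G/N) ≤ k(G)`; the tree's named fact
  `FulmanGuralnick2012_prop35` (`k(GL(n,q)) ≤ qⁿ`, Maslen–Rockmore) implies the hypothesis, whence
  `BCGPU2023_cor34_typeA_of_FulmanGuralnick : FulmanGuralnick2012_prop35 → BCGPU2023_cor34_typeA`.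
* Thm. 3.2 (`BCGPU2023_thm32_holds`), Cor. 3.3 + §2 in effective form
  (`exists_eps_noCertificate_of_secondCharDegree_ge`), Cor. 3.5 (`BCGPU2023_cor35_holds`),
  `|G| ≤ ∑ dᵢ^w` (`card_le_charDegreePowSum`) — all proved in the sibling files.
* "by convexity, `∑ᵢ dᵢ^ω` is minimized if all `dᵢ` are equal": the power-mean inequality
  `∑ᵢ dᵢ^w ≥ |G|^{w/2} k^{1 − w/2}` (`card_rpow_mul_le_charDegreePowSum`, Mathlib
  `Real.rpow_arith_mean_le_arith_mean_rpow`).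

How the uniform `ε` is assembled (the printed "bounded rank" / "large rank" dichotomy made
effective, for an abstract non-abelian finite group `G` with parameters `q ≥ 2`, `m = n − 1 ≥ 1`,
`n(G) ≥ q^m/4`, `k(G) ≤ q^{2m+3}`, `|G| ≤ q^{(m+1)²}` — `exists_eps_noCertificate_family`):
`ε = min(1/200, ε₂, ε₃)` where
* rank `m ≥ 5`: `noCertificate_of_few_classes` (`n(G) ≥ 4` and `k(G)^ε ≤ (n(G)/4)^{2/3}` suffice on
  `[2, 2+ε]`), fed by `k^ε ≤ k^{1/20} ≤ q^{(2m+3)/20} ≤ q^{2m/3}/2^{8/3} ≤ (n(G)/4)^{2/3}`, the middle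
  step being `2^{8/3} ≤ q^{(34m − 9)/60}` (`m ≥ 5`, `q ≥ 2`);
* rank `m ≤ 4`, `|G| ≥ N₀`: Cor. 3.3 with `c = 1/4`, `δ = 4/25` (`n(G) ≥ q^m/4 ≥ ¼|G|^{4/25}` since
  `|G| ≤ q^{(m+1)²}` and `4(m+1)² ≤ 25m` for `1 ≤ m ≤ 4`), giving `ε₂, N₀`;
* `12 ≤ |G| < N₀` (any finite group): Cor. 3.5, `|S||T||U| ≤ |G|^{3/2}(1/√2 + 12^{−1/2}) = θ|G|^{3/2}`
  with `θ < 1` (`exists_eps_noCertificate_of_card_le`), giving `ε₃ = (2/3)(−log θ)/log N₀`;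
* `|G| ≤ 11` (any finite group; in the families only `SL(2,2) ≅ PSL(2,2) ≅ S₃` occurs): the pairwise
  packing bounds `|S||T|, |T||U|, |U||S| ≤ |G|` give `(|S||T||U|)² ≤ |G|³`, and `|S||T||U| ≤ |G|` for
  abelian `G` (orders `4`, `9` by Mathlib's `IsPGroup.isMulCommutative_of_card_eq_prime_sq`); a finite
  check `⌊g^{3/2}⌋^{401} ≤ g^{600}` for the other `g ≤ 11` (`noCertificate_of_card_le_eleven`, `ε ≤ 1/200`).

Main results: `exists_eps_noCertificate_family`, `BCGPU2023_cor34_typeA_of_classNumber_GL`,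
`BCGPU2023_cor34_typeA_of_FulmanGuralnick : FulmanGuralnick2012_prop35 → BCGPU2023_cor34_typeA`, and the
unconditional DISCHARGE **`BCGPU2023_cor34_typeA_holds : BCGPU2023_cor34_typeA`**, the class-number
hypothesis being supplied by the elementary count `k(GL_n(q)) ≤ (2q)ⁿ ≤ q^{2n}` of
`Literature.RepresentationTheory.FiniteGroups.card_conjClasses_GL_le_pow` (`GLnClassNumberBound.lean`,
rational canonical form).  This file introduces no definitions and no named facts.
-/

noncomputable section

open scoped BigOperators MatrixGroups
open Matrix

namespace Literature.Barriers.MatrixMultiplication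

open Literature.RepresentationTheory.FiniteGroups Literature.Combinatorics.Additive

/-! ## §1 Counting conjugacy classes: subgroups, quotients, `SL ≤ GL`, `PSL` -/

section ConjClasses

variable {G : Type} [Group G]

/-- **`k(H) ≤ [G : H] · k(G)`** for a subgroup `H` of a finite group `G` (`k` = number of conjugacy
classes): `k(H)|H| = #{commuting pairs in H} ≤ #{commuting pairs in G} = k(G)|G|` (Gallagher 1970;
here from Mathlib's `card_comm_eq_card_conjClasses_mul_card`).
[cite: BlasiakCohnGrochowPrattUmans2023, Cor. 3.4 (proof: "there are `O(q^r)` conjugacy classes")] -/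
theorem card_conjClasses_subgroup_le [Finite G] (H : Subgroup G) :
    Nat.card (ConjClasses H) ≤ H.index * Nat.card (ConjClasses G) := by
  classical
  have hH : 0 < Nat.card H := Nat.card_pos
  have hinj : Function.Injective
      (fun p : {p : H × H // Commute p.1 p.2} =>
        (⟨((p.1.1 : G), (p.1.2 : G)), p.2.map H.subtype⟩ : {p : G × G // Commute p.1 p.2})) := by
    rintro ⟨⟨a, b⟩, hab⟩ ⟨⟨a', b'⟩, hab'⟩ h
    simp only [Subtype.mk.injEq, Prod.mk.injEq] at h
    exact Subtype.ext (Prod.ext (Subtype.ext h.1) (Subtype.ext h.2))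
  have hle := Nat.card_le_card_of_injective _ hinj
  rw [card_comm_eq_card_conjClasses_mul_card, card_comm_eq_card_conjClasses_mul_card,
    ← Subgroup.card_mul_index H] at hle
  have : Nat.card (ConjClasses H) * Nat.card H ≤ (H.index * Nat.card (ConjClasses G)) * Nat.card H := by
    calc Nat.card (ConjClasses H) * Nat.card H ≤ Nat.card (ConjClasses G) * (Nat.card H * H.index) := hle
      _ = (H.index * Nat.card (ConjClasses G)) * Nat.card H := by ring
  exact Nat.le_of_mul_le_mul_right this hH

/-- `k(G') ≤ k(G)` along a surjective homomorphism `G → G'` (conjugacy classes map onto conjugacy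
classes). [folklore] -/
private theorem card_conjClasses_le_of_surjective [Finite G] {G' : Type} [Group G'] (f : G →* G')
    (hf : Function.Surjective f) : Nat.card (ConjClasses G') ≤ Nat.card (ConjClasses G) :=
  Nat.card_le_card_of_surjective _ (ConjClasses.map_surjective hf)

/-- **`k(SL_n(q)) ≤ (q − 1) · k(GL_n(q))`** (`SL_n = ker det` has index `|F^×| = q − 1` in `GL_n`).
[cite: BlasiakCohnGrochowPrattUmans2023, Cor. 3.4 (proof: "there are `O(q^r)` conjugacy classes")] -/
theorem card_conjClasses_SL_le (n : ℕ) [NeZero n] (F : Type) [Field F] [Fintype F] :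
    Nat.card (ConjClasses (SpecialLinearGroup (Fin n) F)) ≤
      (Fintype.card F - 1) * Nat.card (ConjClasses (GL (Fin n) F)) := by
  classical
  set K := (Matrix.GeneralLinearGroup.det : GL (Fin n) F →* Fˣ).ker with hK
  -- the isomorphism `K = ker det → SL_n(F)` (inverse of `toGL`), as a surjective homomorphism
  have hmem : ∀ k : K, Matrix.det (((k : GL (Fin n) F)) : Matrix (Fin n) (Fin n) F) = 1 := by
    intro k
    have h := k.2
    rw [MonoidHom.mem_ker] at h
    have h' := congrArg Units.val h
    rw [Matrix.GeneralLinearGroup.val_det_apply] at h'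
    exact h'
  let f : K →* SpecialLinearGroup (Fin n) F :=
    MonoidHom.mk' (fun k => ⟨((k : GL (Fin n) F) : Matrix (Fin n) (Fin n) F), hmem k⟩)
      (fun _ _ => Subtype.ext rfl)
  have hf : Function.Surjective f := by
    intro g
    refine ⟨⟨Matrix.SpecialLinearGroup.toGL g, by
      rw [MonoidHom.mem_ker]
      exact Units.ext (by rw [Matrix.GeneralLinearGroup.val_det_apply]; exact g.2)⟩, ?_⟩
    exact Subtype.ext rfl
  have h1 := card_conjClasses_le_of_surjective f hf
  have h2 := card_conjClasses_subgroup_le (G := GL (Fin n) F) K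
  have hidx : K.index = Fintype.card F - 1 := by
    rw [hK, Subgroup.index_ker, MonoidHom.range_eq_top.mpr Matrix.GeneralLinearGroup.det_surjective,
      Subgroup.card_top, Nat.card_eq_fintype_card, Fintype.card_units]
  rw [hidx] at h2
  exact h1.trans h2

/-- **`k(PSL_n(q)) ≤ k(SL_n(q))`** (quotient by the centre).
[cite: BlasiakCohnGrochowPrattUmans2023, Cor. 3.4 (remark after the proof: quotients by centres)] -/
theorem card_conjClasses_PSL_le (n : ℕ) (F : Type) [Field F] [Fintype F] :
    Nat.card (ConjClasses (Matrix.ProjectiveSpecialLinearGroup (Fin n) F)) ≤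
      Nat.card (ConjClasses (SpecialLinearGroup (Fin n) F)) :=
  card_conjClasses_le_of_surjective (QuotientGroup.mk' _) (QuotientGroup.mk'_surjective _)

end ConjClasses

/-! ## §2 "By convexity": `∑ᵢ dᵢ^w ≥ |G|^{w/2} k^{1 − w/2}` -/

section Convexity

variable (G : Type) [Group G] [Fintype G]

/-- The power sum of the degrees as a finite sum over the irreducible characters. [folklore] -/
private theorem charDegreePowSum_eq_sum (s : ℝ) :
    charDegreePowSum G s = ∑ χ ∈ (irrChars_finite_holds G).toFinset, (χ 1).re ^ s := by
  rw [charDegreePowSum, finsum_mem_eq_finite_toFinset_sum _ (irrChars_finite_holds G)]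

/-- `∑_χ χ(1)² = |G|` in real form. [folklore] -/
private theorem sum_re_sq_eq_card :
    ∑ χ ∈ (irrChars_finite_holds G).toFinset, (χ 1).re ^ (2 : ℝ) = Fintype.card G := by
  classical
  have h := sum_sq_charDegrees_holds G
  rw [finsum_mem_eq_finite_toFinset_sum _ (irrChars_finite_holds G), Nat.card_eq_fintype_card] at h
  have h' := congrArg Complex.re h
  rw [Complex.re_sum, Complex.natCast_re] at h'
  rw [← h']
  refine Finset.sum_congr rfl fun χ hχ => ?_
  obtain ⟨d, -, hd⟩ := IsIrrChar.exists_apply_one ((irrChars_finite_holds G).mem_toFinset.mp hχ)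
  rw [hd, Real.rpow_two]
  norm_cast

/-- The number of irreducible characters is positive (the trivial character). [folklore] -/
private theorem card_irrChars_toFinset_pos : 0 < (irrChars_finite_holds G).toFinset.card :=
  Finset.card_pos.mpr ⟨_, (irrChars_finite_holds G).mem_toFinset.mpr character_trivial_mem_irrChars⟩

/-- **"By convexity, `∑ᵢ dᵢ^ω` is minimized (for fixed number of summands) if all `dᵢ` are
equal"**: for `w ≥ 2`, `|G|^{w/2} · k^{1 − w/2} ≤ ∑ᵢ dᵢ^w`, `k` the number of conjugacy classes
(= the number of irreducible characters). Power-mean inequality applied to `dᵢ²` with exponent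
`w/2 ≥ 1`. [cite: BlasiakCohnGrochowPrattUmans2023, Cor. 3.4 (proof)] -/
theorem card_rpow_mul_le_charDegreePowSum {w : ℝ} (hw : 2 ≤ w) :
    (Fintype.card G : ℝ) ^ (w / 2) * (Nat.card (ConjClasses G) : ℝ) ^ (1 - w / 2) ≤
      charDegreePowSum G w := by
  classical
  set Fs := (irrChars_finite_holds G).toFinset with hFs
  set k : ℕ := Fs.card with hk
  have hkpos : 0 < k := card_irrChars_toFinset_pos G
  have hk0 : (0 : ℝ) < k := Nat.cast_pos.mpr hkpos
  have hkc : (Nat.card (ConjClasses G) : ℝ) = k := by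
    rw [hk, hFs, card_irrChars_eq_card_conjClasses]
  rw [hkc, charDegreePowSum_eq_sum]
  -- Jensen / power mean with weights `1/k`, points `dᵢ²`, exponent `w/2`
  have hx0 : ∀ χ ∈ Fs, 0 ≤ (χ 1).re := by
    intro χ hχ
    obtain ⟨d, -, hd⟩ := IsIrrChar.exists_apply_one ((irrChars_finite_holds G).mem_toFinset.mp hχ)
    rw [hd, Complex.natCast_re]; exact Nat.cast_nonneg d
  have hp : 1 ≤ w / 2 := by linarith
  have hJ := Real.rpow_arith_mean_le_arith_mean_rpow Fs (fun _ => (1 : ℝ) / k)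
    (fun χ => (χ 1).re ^ (2 : ℝ)) (fun _ _ => by positivity)
    (by rw [Finset.sum_const, nsmul_eq_mul, ← hk]; field_simp)
    (fun χ hχ => Real.rpow_nonneg (hx0 χ hχ) _) hp
  -- rewrite both sides
  have hL : ∑ χ ∈ Fs, (1 : ℝ) / k * (χ 1).re ^ (2 : ℝ) = (Fintype.card G : ℝ) / k := by
    rw [← Finset.mul_sum, sum_re_sq_eq_card]; ring
  have hR : ∑ χ ∈ Fs, (1 : ℝ) / k * ((χ 1).re ^ (2 : ℝ)) ^ (w / 2) =
      (1 / k) * ∑ χ ∈ Fs, (χ 1).re ^ w := by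
    rw [Finset.mul_sum]
    refine Finset.sum_congr rfl fun χ hχ => ?_
    rw [← Real.rpow_mul (hx0 χ hχ), show (2 : ℝ) * (w / 2) = w by ring]
  rw [hL, hR] at hJ
  -- `(|G|/k)^{w/2} ≤ (1/k) Σ dᵢ^w`, i.e. `k (|G|/k)^{w/2} ≤ Σ dᵢ^w`
  have hG0 : (0 : ℝ) ≤ Fintype.card G := Nat.cast_nonneg _
  have key : (k : ℝ) * ((Fintype.card G : ℝ) / k) ^ (w / 2) ≤ ∑ χ ∈ Fs, (χ 1).re ^ w := by
    have := mul_le_mul_of_nonneg_left hJ hk0.le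
    rwa [← mul_assoc, mul_one_div_cancel hk0.ne', one_mul] at this
  calc (Fintype.card G : ℝ) ^ (w / 2) * (k : ℝ) ^ (1 - w / 2)
      = (k : ℝ) * ((Fintype.card G : ℝ) / k) ^ (w / 2) := by
        rw [Real.div_rpow hG0 hk0.le, Real.rpow_sub hk0, Real.rpow_one]
        field_simp
    _ ≤ _ := key

end Convexity

/-! ## §3 `n(G)` for `SL_n(q)` and `PSL_n(q)` -/

section SecondDegree

/-- A lower bound for all degrees `> 1` is a lower bound for `n(G)` (when some degree `> 1` exists).
[folklore] -/
private theorem le_secondCharDegree {G : Type} [Group G] {b : ℕ}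
    (hne : ∃ d ∈ charDegrees G, 1 < d) (h : ∀ d ∈ charDegrees G, 1 < d → b ≤ d) :
    b ≤ secondCharDegree G := by
  have hne' : {d : ℕ | d ∈ charDegrees G ∧ 1 < d}.Nonempty := by
    obtain ⟨d, hd, h1⟩ := hne; exact ⟨d, hd, h1⟩
  have hmem := Nat.sInf_mem hne'
  exact h _ hmem.1 hmem.2

/-- `n(G)` is a character degree `> 1` of a non-abelian finite group. [folklore] -/
private theorem secondCharDegree_mem {G : Type} [Group G] [Finite G] (hG : ∃ a b : G, a * b ≠ b * a) :
    secondCharDegree G ∈ charDegrees G ∧ 1 < secondCharDegree G := by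
  have hne' : {d : ℕ | d ∈ charDegrees G ∧ 1 < d}.Nonempty := by
    obtain ⟨d, hd, h1⟩ := Serre1977_thm9_holds.exists_one_lt_mem_charDegrees G hG
    exact ⟨d, hd, h1⟩
  exact Nat.sInf_mem hne'

/-- `n(G) ≤ |G|` (indeed `n(G)² ≤ |G| − 1`, the tree's `sq_charDegree_le_holds`). [folklore] -/
private theorem secondCharDegree_le_card {G : Type} [Group G] [Fintype G] (hG : ∃ a b : G, a * b ≠ b * a) :
    secondCharDegree G ≤ Fintype.card G := by
  obtain ⟨hmem, h1⟩ := secondCharDegree_mem hG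
  obtain ⟨a, b, hab⟩ := hG
  haveI : Nontrivial G := ⟨⟨a, 1, fun h => hab (by rw [h, one_mul, mul_one])⟩⟩
  have h := sq_charDegree_le_holds G (secondCharDegree G) hmem
  rw [Nat.card_eq_fintype_card] at h
  calc secondCharDegree G ≤ secondCharDegree G ^ 2 := Nat.le_self_pow two_ne_zero _
    _ ≤ Fintype.card G - 1 := h
    _ ≤ Fintype.card G := Nat.sub_le _ _

variable {F : Type} [Field F] [Fintype F] [DecidableEq F] {m : ℕ}

/-- `0 ≠ last` in `Fin (m + 1)` for `m ≥ 1`. [folklore] -/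
private theorem zero_ne_last (hm : 1 ≤ m) : (0 : Fin (m + 1)) ≠ Fin.last m := by
  intro h
  have := congrArg Fin.val h
  simp at this
  omega

omit [Fintype F] [DecidableEq F] in
/-- Entries of the two products of the transvections `x = 1 + E_{0,last}` and `y = 1 + E_{last,0}`:
`(xy)_{00} = 2`, `(yx)_{00} = 1`, `(xy)_{0,last} = 1 = (yx)_{0,last}`. [folklore] -/
private theorem transvection_products (hm : 1 ≤ m) :
    (transvection (0 : Fin (m + 1)) (Fin.last m) (1 : F) * transvection (Fin.last m) 0 (1 : F)) 0 0 = 2 ∧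
    (transvection (Fin.last m) (0 : Fin (m + 1)) (1 : F) * transvection 0 (Fin.last m) (1 : F)) 0 0 = 1 ∧
    (transvection (0 : Fin (m + 1)) (Fin.last m) (1 : F) * transvection (Fin.last m) 0 (1 : F)) 0
        (Fin.last m) = 1 ∧
    (transvection (Fin.last m) (0 : Fin (m + 1)) (1 : F) * transvection 0 (Fin.last m) (1 : F)) 0
        (Fin.last m) = 1 := by
  have hij : (0 : Fin (m + 1)) ≠ Fin.last m := zero_ne_last hm
  have hji : Fin.last m ≠ (0 : Fin (m + 1)) := hij.symm
  refine ⟨?_, ?_, ?_, ?_⟩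
  · rw [Matrix.transvection_mul_apply_same]
    simp [Matrix.transvection, hji]
    norm_num
  · rw [Matrix.transvection_mul_apply_of_ne (ha := hij)]
    have h0 : ¬((0 : Fin (m + 1)) = 0 ∧ Fin.last m = 0) := fun h => hji h.2
    simp only [Matrix.transvection, Matrix.add_apply, Matrix.one_apply_eq,
      Matrix.single_apply_of_ne (h := h0), add_zero]
  · rw [Matrix.transvection_mul_apply_same]
    simp [Matrix.transvection, hij, hji]
  · rw [Matrix.transvection_mul_apply_of_ne (ha := hij)]
    simp [Matrix.transvection, hij]

omit [Fintype F] [DecidableEq F] in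
/-- **`SL_n(F)` is non-abelian for `n ≥ 2`.** [folklore] -/
private theorem exists_not_commute_SL (hm : 1 ≤ m) :
    ∃ a b : SpecialLinearGroup (Fin (m + 1)) F, a * b ≠ b * a := by
  have hij : (0 : Fin (m + 1)) ≠ Fin.last m := zero_ne_last hm
  refine ⟨Matrix.SpecialLinearGroup.transvection hij 1, Matrix.SpecialLinearGroup.transvection hij.symm 1,
    fun h => ?_⟩
  have h' := congrArg (fun g : SpecialLinearGroup (Fin (m + 1)) F =>
    (g : Matrix (Fin (m + 1)) (Fin (m + 1)) F) 0 0) h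
  simp only [Matrix.SpecialLinearGroup.coe_mul] at h'
  change (transvection (0 : Fin (m + 1)) (Fin.last m) (1 : F) * transvection (Fin.last m) 0 (1 : F)) 0 0 =
    (transvection (Fin.last m) (0 : Fin (m + 1)) (1 : F) * transvection 0 (Fin.last m) (1 : F)) 0 0 at h'
  obtain ⟨h1, h2, -, -⟩ := transvection_products (F := F) hm
  rw [h1, h2] at h'
  exact one_ne_zero (by linear_combination h')

omit [Fintype F] [DecidableEq F] in
/-- **`PSL_n(F)` is non-abelian for `n ≥ 2`**: the commutator of the two transvections above is not a
scalar matrix (it has the off-diagonal pattern of `[[0,−1],[1,3]]`), hence not central. [folklore] -/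
private theorem exists_not_commute_PSL (hm : 1 ≤ m) :
    ∃ a b : Matrix.ProjectiveSpecialLinearGroup (Fin (m + 1)) F, a * b ≠ b * a := by
  have hij : (0 : Fin (m + 1)) ≠ Fin.last m := zero_ne_last hm
  set x : SpecialLinearGroup (Fin (m + 1)) F := Matrix.SpecialLinearGroup.transvection hij 1 with hx
  set y : SpecialLinearGroup (Fin (m + 1)) F := Matrix.SpecialLinearGroup.transvection hij.symm 1 with hy
  refine ⟨QuotientGroup.mk x, QuotientGroup.mk y, fun h => ?_⟩
  rw [← QuotientGroup.mk_mul, ← QuotientGroup.mk_mul, QuotientGroup.eq] at h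
  obtain ⟨r, -, hr⟩ := Matrix.SpecialLinearGroup.mem_center_iff.mp h
  -- `y x = (x y) · scalar r = r • (x y)` as matrices
  have hyx : ((y * x : SpecialLinearGroup (Fin (m + 1)) F) : Matrix (Fin (m + 1)) (Fin (m + 1)) F) =
      r • ((x * y : SpecialLinearGroup (Fin (m + 1)) F) : Matrix (Fin (m + 1)) (Fin (m + 1)) F) := by
    have h1 : (x * y) * ((x * y)⁻¹ * (y * x)) = y * x := by group
    calc ((y * x : SpecialLinearGroup (Fin (m + 1)) F) : Matrix (Fin (m + 1)) (Fin (m + 1)) F)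
        = (((x * y) * ((x * y)⁻¹ * (y * x)) : SpecialLinearGroup (Fin (m + 1)) F) :
            Matrix (Fin (m + 1)) (Fin (m + 1)) F) := by rw [h1]
      _ = ((x * y : SpecialLinearGroup (Fin (m + 1)) F) : Matrix (Fin (m + 1)) (Fin (m + 1)) F) *
            scalar (Fin (m + 1)) r := by rw [Matrix.SpecialLinearGroup.coe_mul, hr]
      _ = r • ((x * y : SpecialLinearGroup (Fin (m + 1)) F) : Matrix (Fin (m + 1)) (Fin (m + 1)) F) := by
            rw [Matrix.scalar_apply, ← Matrix.smul_one_eq_diagonal, Matrix.mul_smul, Matrix.mul_one]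
  obtain ⟨h1, h2, h3, h4⟩ := transvection_products (F := F) hm
  have exy : ((x * y : SpecialLinearGroup (Fin (m + 1)) F) : Matrix (Fin (m + 1)) (Fin (m + 1)) F) =
      transvection (0 : Fin (m + 1)) (Fin.last m) (1 : F) * transvection (Fin.last m) 0 (1 : F) := by
    rw [Matrix.SpecialLinearGroup.coe_mul]; rfl
  have eyx : ((y * x : SpecialLinearGroup (Fin (m + 1)) F) : Matrix (Fin (m + 1)) (Fin (m + 1)) F) =
      transvection (Fin.last m) (0 : Fin (m + 1)) (1 : F) * transvection 0 (Fin.last m) (1 : F) := by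
    rw [Matrix.SpecialLinearGroup.coe_mul]; rfl
  rw [exy, eyx] at hyx
  have e1 := congrFun (congrFun hyx 0) (Fin.last m)
  have e2 := congrFun (congrFun hyx 0) 0
  simp only [Matrix.smul_apply, smul_eq_mul] at e1 e2
  rw [h4, h3, mul_one] at e1
  rw [h2, h1, ← e1, one_mul] at e2
  exact one_ne_zero (by linear_combination -e2)

/-- `|SL_{m+1}(F)| ≤ q^{(m+1)²}` (a subset of the `(m+1) × (m+1)` matrices). [folklore] -/
private theorem card_SL_le : Fintype.card (SpecialLinearGroup (Fin (m + 1)) F) ≤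
    Fintype.card F ^ ((m + 1) * (m + 1)) := by
  calc Fintype.card (SpecialLinearGroup (Fin (m + 1)) F)
      ≤ Fintype.card (Matrix (Fin (m + 1)) (Fin (m + 1)) F) :=
        Fintype.card_le_of_injective _ Subtype.val_injective
    _ = Fintype.card F ^ ((m + 1) * (m + 1)) := by
        change Fintype.card (Fin (m + 1) → Fin (m + 1) → F) = _
        rw [Fintype.card_fun, Fintype.card_fun, Fintype.card_fin, ← pow_mul, mul_comm]

/-- `|PSL_{m+1}(F)| ≤ |SL_{m+1}(F)|`. [folklore] -/
private theorem card_PSL_le : Fintype.card (Matrix.ProjectiveSpecialLinearGroup (Fin (m + 1)) F) ≤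
    Fintype.card (SpecialLinearGroup (Fin (m + 1)) F) :=
  Fintype.card_le_of_surjective _ (QuotientGroup.mk_surjective)

/-- **`n(SL_{m+1}(q)) ≥ q^m/4`** (`m ≥ 1`): from Landazuri–Seitz Lemma 3.1 in the tree
(`(q−1)/2 ≥ q/4` for `m = 1`, `q^m − 1 ≥ q^m/2` for `m ≥ 2`).
[cite: LandazuriSeitz1974, Lemma 3.1] -/
theorem secondCharDegree_SL_ge (hm : 1 ≤ m) :
    (Fintype.card F : ℝ) ^ m / 4 ≤ secondCharDegree (SpecialLinearGroup (Fin (m + 1)) F) := by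
  have hq : 2 ≤ Fintype.card F := Fintype.one_lt_card
  have hq' : (2 : ℝ) ≤ Fintype.card F := by exact_mod_cast hq
  obtain ⟨hmem, h1⟩ := secondCharDegree_mem (exists_not_commute_SL (F := F) hm)
  rcases Nat.lt_or_ge m 2 with hlt | hge
  · obtain rfl : m = 1 := by omega
    have h := SLn.card_le_two_mul_charDegree_add_one (F := F) le_rfl hmem h1
    have h' : (Fintype.card F : ℝ) ≤ 2 * secondCharDegree (SpecialLinearGroup (Fin (1 + 1)) F) + 1 := by
      exact_mod_cast h
    rw [pow_one]
    linarith
  · have h := SLn.le_charDegree_of_three_le (F := F) hge hmem h1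
    have hpow : 1 ≤ Fintype.card F ^ m := Nat.one_le_pow _ _ (by omega)
    have h' : (Fintype.card F : ℝ) ^ m - 1 ≤ secondCharDegree (SpecialLinearGroup (Fin (m + 1)) F) := by
      have := (Nat.cast_le (α := ℝ)).mpr h
      push_cast [Nat.cast_sub hpow] at this
      exact this
    have h2m : (2 : ℝ) ≤ (Fintype.card F : ℝ) ^ m := by
      calc (2 : ℝ) = 2 ^ 1 := by norm_num
        _ ≤ (Fintype.card F : ℝ) ^ 1 := by rw [pow_one, pow_one]; exact hq'
        _ ≤ (Fintype.card F : ℝ) ^ m := pow_le_pow_right₀ (by linarith) hm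
    linarith

/-- **`n(PSL_{m+1}(q)) ≥ q^m/4`** (`m ≥ 1`): every irreducible character of `PSL` inflates to an
irreducible character of `SL` of the same degree (the tree's `IsIrrChar.comp_quotientMk`).
[cite: BlasiakCohnGrochowPrattUmans2023, Cor. 3.4 (remark: "also for simple groups that are quotients of groups of Lie type by their centers")] -/
theorem secondCharDegree_PSL_ge (hm : 1 ≤ m) :
    (Fintype.card F : ℝ) ^ m / 4 ≤
      secondCharDegree (Matrix.ProjectiveSpecialLinearGroup (Fin (m + 1)) F) := by
  have hSL := secondCharDegree_SL_ge (F := F) hm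
  have hne := Serre1977_thm9_holds.exists_one_lt_mem_charDegrees _ (exists_not_commute_PSL (F := F) hm)
  have key : secondCharDegree (SpecialLinearGroup (Fin (m + 1)) F) ≤
      secondCharDegree (Matrix.ProjectiveSpecialLinearGroup (Fin (m + 1)) F) := by
    refine le_secondCharDegree hne fun d hd h1 => ?_
    -- `d` is a character degree of `SL` as well
    obtain ⟨χ, hχ, hχd⟩ := exists_isIrrChar_of_mem_charDegrees hd
    have hχ' : IsIrrChar (SpecialLinearGroup (Fin (m + 1)) F) (χ ∘ QuotientGroup.mk) :=
      IsIrrChar.comp_quotientMk (Subgroup.center _) hχ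
    obtain ⟨d', hd', hd'eq⟩ := hχ'.exists_apply_one
    have hdd' : d = d' := by
      have : (d : ℂ) = d' := by rw [← hχd, ← hd'eq]; rfl
      exact_mod_cast this
    rw [hdd'] at h1 ⊢
    exact (secondCharDegree_le hd' h1).2
  exact hSL.trans (by exact_mod_cast key)

end SecondDegree

/-! ## §4 The three regimes for a single finite group -/

section Regimes

variable (G : Type) [Group G] [Fintype G]

/-- Pairwise packing bound `|S| |T| ≤ |G|` for a TPP triple with `U ≠ ∅` (`(s, t) ↦ s⁻¹ t` is
injective). [cite: BlasiakCohnGrochowPrattUmans2023, §2 (packing bound)] -/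
theorem card_mul_card_le_of_tpp {S T U : Finset G} (h : TripleProductProperty S T U)
    (hU : U.Nonempty) : S.card * T.card ≤ Fintype.card G := by
  classical
  obtain ⟨u, hu⟩ := hU
  rw [← Finset.card_product, ← Finset.card_univ]
  refine Finset.card_le_card_of_injOn (fun p : G × G => p.1⁻¹ * p.2) (fun _ _ => Finset.mem_univ _) ?_
  rintro ⟨s, t⟩ hst ⟨s', t'⟩ hst' (he : s⁻¹ * t = s'⁻¹ * t')
  simp only [Finset.coe_product, Set.mem_prod, Finset.mem_coe] at hst hst'
  have key : s' * s⁻¹ * (t * t'⁻¹) * (u * u⁻¹) = 1 := by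
    calc s' * s⁻¹ * (t * t'⁻¹) * (u * u⁻¹) = s' * (s⁻¹ * t) * t'⁻¹ := by group
      _ = s' * (s'⁻¹ * t') * t'⁻¹ := by rw [he]
      _ = 1 := by group
  obtain ⟨h1, h2, -⟩ := h s' hst'.1 s hst.1 t hst.2 t' hst'.2 u hu u hu key
  exact Prod.ext h1.symm h2

/-- `(|S||T||U|)² ≤ |G|³` for a TPP triple of non-empty sets (product of the three pairwise packing
bounds, using the cyclic symmetry `TripleProductProperty.rotate`).
[cite: BlasiakCohnGrochowPrattUmans2023, §2 (packing bound)] -/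
theorem card_prod_sq_le_of_tpp {S T U : Finset G} (h : TripleProductProperty S T U) (hS : S.Nonempty)
    (hT : T.Nonempty) (hU : U.Nonempty) :
    (S.card * T.card * U.card) * (S.card * T.card * U.card) ≤ Fintype.card G ^ 3 := by
  have h1 := card_mul_card_le_of_tpp G h hU
  have h2 := card_mul_card_le_of_tpp G h.rotate hS
  have h3 := card_mul_card_le_of_tpp G h.rotate.rotate hT
  calc (S.card * T.card * U.card) * (S.card * T.card * U.card)
      = (S.card * T.card) * ((T.card * U.card) * (U.card * S.card)) := by ring
    _ ≤ Fintype.card G * (Fintype.card G * Fintype.card G) :=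
        Nat.mul_le_mul h1 (Nat.mul_le_mul h2 h3)
    _ = Fintype.card G ^ 3 := by ring

/-- **Large rank ("few conjugacy classes")**: if `n(G) ≥ 4` and `k(G)^ε ≤ (n(G)/4)^{2/3}` (`k(G)` the
class number), then Thm. 2.2's inequality holds for every TPP triple and every `w ∈ [2, 2 + ε]`:
`|S||T||U| ≤ 2|G|^{3/2}/√n(G)` (Thm. 3.2) and `∑ dᵢ^w ≥ |G|^{w/2} k^{1−w/2}` (convexity).
[cite: BlasiakCohnGrochowPrattUmans2023, Cor. 3.4 (proof, large rank)] -/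
theorem noCertificate_of_few_classes (hG : ∃ a b : G, a * b ≠ b * a) {ε : ℝ}
    (h4 : 4 ≤ secondCharDegree G)
    (hk : (Nat.card (ConjClasses G) : ℝ) ^ ε ≤ ((secondCharDegree G : ℝ) / 4) ^ (2 / 3 : ℝ))
    (S T U : Finset G) (hTPP : TripleProductProperty S T U) {w : ℝ} (hw2 : 2 ≤ w) (hwε : w ≤ 2 + ε) :
    ((S.card * T.card * U.card : ℕ) : ℝ) ^ (w / 3) ≤ charDegreePowSum G w := by
  set g : ℝ := (Fintype.card G : ℝ) with hg
  set ν : ℝ := ((secondCharDegree G : ℕ) : ℝ) with hν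
  set k : ℝ := ((Nat.card (ConjClasses G) : ℕ) : ℝ) with hkdef
  set N : ℝ := ((S.card * T.card * U.card : ℕ) : ℝ) with hN
  have hg1 : (1 : ℝ) ≤ g := by rw [hg]; exact_mod_cast Fintype.card_pos
  have hg0 : 0 < g := by linarith
  have hν4 : (4 : ℝ) ≤ ν := by rw [hν]; exact_mod_cast h4
  have hν0 : 0 < ν := by linarith
  have hk1 : (1 : ℝ) ≤ k := by
    rw [hkdef]
    have : 0 < Nat.card (ConjClasses G) := Nat.card_pos
    exact_mod_cast this
  have hk0 : 0 < k := by linarith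
  have hN0 : 0 ≤ N := Nat.cast_nonneg _
  have hw3 : 0 ≤ w / 3 := by linarith
  -- Thm. 3.2 and `n(G) ≤ |G|`: `N ≤ 2 g^{3/2} / √ν`
  have h32 : N ≤ g ^ (3 / 2 : ℝ) / Real.sqrt ν + g := BCGPU2023_thm32_holds G hG S T U hTPP
  have hνg : ν ≤ g := by rw [hν, hg]; exact_mod_cast secondCharDegree_le_card hG
  have hsq : Real.sqrt ν ≤ Real.sqrt g := Real.sqrt_le_sqrt hνg
  have hsν0 : 0 < Real.sqrt ν := Real.sqrt_pos.mpr hν0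
  have hg32 : g ^ (3 / 2 : ℝ) = g * Real.sqrt g := by
    rw [show (3 / 2 : ℝ) = 1 + 1 / 2 by norm_num, Real.rpow_add hg0, Real.rpow_one, Real.sqrt_eq_rpow]
  have hgA : g ≤ g ^ (3 / 2 : ℝ) / Real.sqrt ν := by
    rw [hg32, le_div_iff₀ hsν0]
    exact mul_le_mul_of_nonneg_left hsq hg0.le
  have hN2 : N ≤ 2 * (g ^ (3 / 2 : ℝ) / Real.sqrt ν) := by linarith
  -- exponent bookkeeping: `2^{w/3} k^{w/2-1} ≤ ν^{w/6}`
  have hν41 : (1 : ℝ) ≤ ν / 4 := by rw [le_div_iff₀ (by norm_num : (0:ℝ) < 4)]; linarith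
  have hmain : (2 : ℝ) ^ (w / 3) * k ^ (w / 2 - 1) ≤ ν ^ (w / 6) := by
    have h1 : k ^ (w / 2 - 1) ≤ k ^ (ε / 2) :=
      Real.rpow_le_rpow_of_exponent_le hk1 (by linarith)
    have h2 : k ^ (ε / 2) = (k ^ ε) ^ (1 / 2 : ℝ) := by
      rw [← Real.rpow_mul hk0.le]; ring_nf
    have h3 : (k ^ ε) ^ (1 / 2 : ℝ) ≤ ((ν / 4) ^ (2 / 3 : ℝ)) ^ (1 / 2 : ℝ) :=
      Real.rpow_le_rpow (Real.rpow_nonneg hk0.le ε) hk (by norm_num)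
    have h4' : ((ν / 4) ^ (2 / 3 : ℝ)) ^ (1 / 2 : ℝ) = (ν / 4) ^ (1 / 3 : ℝ) := by
      rw [← Real.rpow_mul (by linarith)]; norm_num
    have h5 : (ν / 4) ^ (1 / 3 : ℝ) ≤ (ν / 4) ^ (w / 6) :=
      Real.rpow_le_rpow_of_exponent_le hν41 (by linarith)
    have h6 : (ν / 4) ^ (w / 6) = ν ^ (w / 6) / (2 : ℝ) ^ (w / 3) := by
      rw [Real.div_rpow hν0.le (by norm_num), show (4 : ℝ) = 2 ^ (2 : ℝ) by norm_num,
        ← Real.rpow_mul (by norm_num)]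
      ring_nf
    have h2w : 0 < (2 : ℝ) ^ (w / 3) := Real.rpow_pos_of_pos two_pos _
    have hchain : k ^ (w / 2 - 1) ≤ ν ^ (w / 6) / (2 : ℝ) ^ (w / 3) := by
      calc k ^ (w / 2 - 1) ≤ k ^ (ε / 2) := h1
        _ = (k ^ ε) ^ (1 / 2 : ℝ) := h2
        _ ≤ ((ν / 4) ^ (2 / 3 : ℝ)) ^ (1 / 2 : ℝ) := h3
        _ = (ν / 4) ^ (1 / 3 : ℝ) := h4'
        _ ≤ (ν / 4) ^ (w / 6) := h5
        _ = ν ^ (w / 6) / (2 : ℝ) ^ (w / 3) := h6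
    rw [le_div_iff₀ h2w] at hchain
    linarith [hchain]
  -- the right-hand side
  have hR := card_rpow_mul_le_charDegreePowSum G hw2
  rw [← hg, ← hkdef] at hR
  have hgw : 0 < g ^ (w / 2) := Real.rpow_pos_of_pos hg0 _
  -- `2^{w/3}/ν^{w/6} ≤ k^{1-w/2}`
  have hkk : k ^ (w / 2 - 1) * k ^ (1 - w / 2) = 1 := by
    rw [← Real.rpow_add hk0, show w / 2 - 1 + (1 - w / 2) = 0 by ring, Real.rpow_zero]
  have hνw : 0 < ν ^ (w / 6) := Real.rpow_pos_of_pos hν0 _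
  have hk1w : 0 < k ^ (1 - w / 2) := Real.rpow_pos_of_pos hk0 _
  have hquot : (2 : ℝ) ^ (w / 3) / ν ^ (w / 6) ≤ k ^ (1 - w / 2) := by
    rw [div_le_iff₀ hνw]
    have := mul_le_mul_of_nonneg_right hmain hk1w.le
    rw [mul_assoc, hkk, mul_one] at this
    linarith [this]
  -- `N^{w/3} ≤ (2 g^{3/2}/√ν)^{w/3} = g^{w/2} · (2^{w/3} / ν^{w/6})`
  have hA0 : 0 ≤ 2 * (g ^ (3 / 2 : ℝ) / Real.sqrt ν) := by positivity
  have hpow : (2 * (g ^ (3 / 2 : ℝ) / Real.sqrt ν)) ^ (w / 3) =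
      g ^ (w / 2) * ((2 : ℝ) ^ (w / 3) / ν ^ (w / 6)) := by
    rw [Real.mul_rpow (by norm_num) (by positivity), Real.div_rpow (by positivity) (Real.sqrt_nonneg _),
      ← Real.rpow_mul hg0.le, Real.sqrt_eq_rpow, ← Real.rpow_mul hν0.le]
    ring_nf
  calc N ^ (w / 3) ≤ (2 * (g ^ (3 / 2 : ℝ) / Real.sqrt ν)) ^ (w / 3) :=
        Real.rpow_le_rpow hN0 hN2 hw3
    _ = g ^ (w / 2) * ((2 : ℝ) ^ (w / 3) / ν ^ (w / 6)) := hpow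
    _ ≤ g ^ (w / 2) * k ^ (1 - w / 2) := mul_le_mul_of_nonneg_left hquot hgw.le
    _ ≤ charDegreePowSum G w := hR

/-- `θ = 1/√2 + 1/√12 < 1` (`≈ 0.9958`). [folklore] -/
private theorem theta_lt_one : 1 / Real.sqrt 2 + 1 / Real.sqrt 12 < 1 := by
  have h2 : (1.414 : ℝ) < Real.sqrt 2 := (Real.lt_sqrt (by norm_num)).mpr (by norm_num)
  have h12 : (3.464 : ℝ) < Real.sqrt 12 := (Real.lt_sqrt (by norm_num)).mpr (by norm_num)
  have e2 : 1 / Real.sqrt 2 < 1 / 1.414 := one_div_lt_one_div_of_lt (by norm_num) h2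
  have e12 : 1 / Real.sqrt 12 < 1 / 3.464 := one_div_lt_one_div_of_lt (by norm_num) h12
  have : (1 : ℝ) / 1.414 + 1 / 3.464 < 1 := by norm_num
  linarith

/-- **Small groups** (Cor. 3.5): for every bound `N₀` there is `ε > 0` such that in every finite group
with `12 ≤ |G| ≤ N₀` Thm. 2.2's inequality holds on `[2, 2 + ε]` for all TPP triples:
`|S||T||U| ≤ |G|^{3/2}/√2 + |G| ≤ θ |G|^{3/2}` with `θ = 1/√2 + 12^{−1/2} < 1`.
[cite: BlasiakCohnGrochowPrattUmans2023, Cor. 3.5] -/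
theorem exists_eps_noCertificate_of_card_le (N₀ : ℝ) :
    ∃ ε : ℝ, 0 < ε ∧ ∀ (G : Type) [Group G] [Fintype G], 12 ≤ Fintype.card G →
      (Fintype.card G : ℝ) ≤ N₀ → ∀ (S T U : Finset G), TripleProductProperty S T U →
      ∀ w : ℝ, 2 ≤ w → w ≤ 2 + ε →
        ((S.card * T.card * U.card : ℕ) : ℝ) ^ (w / 3) ≤ charDegreePowSum G w := by
  by_cases hN₀ : N₀ < 12
  · refine ⟨1, one_pos, fun G _ _ h12 hle S T U _ w _ _ => ?_⟩
    exfalso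
    have : (12 : ℝ) ≤ Fintype.card G := by exact_mod_cast h12
    linarith
  push Not at hN₀
  set θ : ℝ := 1 / Real.sqrt 2 + 1 / Real.sqrt 12 with hθ
  have hθ1 : θ < 1 := theta_lt_one
  have hθ0 : 0 < θ := by positivity
  have hlogθ : 0 < -Real.log θ := by
    have := Real.log_neg hθ0 hθ1
    linarith
  have hL : 0 < Real.log N₀ := Real.log_pos (by linarith)
  refine ⟨2 / 3 * (-Real.log θ) / Real.log N₀, by positivity, ?_⟩
  intro G _ _ h12 hle S T U hTPP w hw2 hwε
  set g : ℝ := (Fintype.card G : ℝ) with hg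
  set N : ℝ := ((S.card * T.card * U.card : ℕ) : ℝ) with hN
  have hg12 : (12 : ℝ) ≤ g := by rw [hg]; exact_mod_cast h12
  have hg0 : 0 < g := by linarith
  have hN0 : 0 ≤ N := Nat.cast_nonneg _
  -- Cor. 3.5: `N ≤ g^{3/2}/√2 + g ≤ θ g^{3/2}`
  have h35 : N ≤ g ^ (3 / 2 : ℝ) / Real.sqrt 2 + g := BCGPU2023_cor35_holds G S T U hTPP
  have hg32 : g ^ (3 / 2 : ℝ) = g * Real.sqrt g := by
    rw [show (3 / 2 : ℝ) = 1 + 1 / 2 by norm_num, Real.rpow_add hg0, Real.rpow_one, Real.sqrt_eq_rpow]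
  have hsg : Real.sqrt 12 ≤ Real.sqrt g := Real.sqrt_le_sqrt hg12
  have hs12 : 0 < Real.sqrt 12 := Real.sqrt_pos.mpr (by norm_num)
  have hgle : g ≤ g ^ (3 / 2 : ℝ) * (1 / Real.sqrt 12) := by
    rw [hg32, mul_one_div, le_div_iff₀ hs12]
    exact mul_le_mul_of_nonneg_left hsg hg0.le
  have hNθ : N ≤ θ * g ^ (3 / 2 : ℝ) := by
    have : g ^ (3 / 2 : ℝ) / Real.sqrt 2 = g ^ (3 / 2 : ℝ) * (1 / Real.sqrt 2) := by ring
    rw [hθ]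
    nlinarith [h35, hgle, this]
  -- `N^{w/3} ≤ θ^{w/3} g^{w/2} ≤ θ^{2/3} · g · g^{w/2 - 1} ≤ θ^{2/3} θ^{-1/3} g ≤ g`
  have hw3 : 0 ≤ w / 3 := by linarith
  have h1 : N ^ (w / 3) ≤ (θ * g ^ (3 / 2 : ℝ)) ^ (w / 3) := Real.rpow_le_rpow hN0 hNθ hw3
  have h2 : (θ * g ^ (3 / 2 : ℝ)) ^ (w / 3) = θ ^ (w / 3) * (g * g ^ (w / 2 - 1)) := by
    rw [Real.mul_rpow hθ0.le (by positivity), ← Real.rpow_mul hg0.le,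
      show (3 / 2 : ℝ) * (w / 3) = 1 + (w / 2 - 1) by ring, Real.rpow_add hg0, Real.rpow_one]
  have h3 : θ ^ (w / 3) ≤ θ ^ (2 / 3 : ℝ) :=
    Real.rpow_le_rpow_of_exponent_ge hθ0 hθ1.le (by linarith)
  have h4 : g ^ (w / 2 - 1) ≤ θ ^ (-(1 / 3) : ℝ) := by
    rw [Real.rpow_def_of_pos hg0, Real.rpow_def_of_pos hθ0]
    apply Real.exp_le_exp.mpr
    have hlg : Real.log g ≤ Real.log N₀ := Real.log_le_log hg0 hle
    have hlg0 : 0 ≤ Real.log g := Real.log_nonneg (by linarith)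
    have hw' : w / 2 - 1 ≤ (2 / 3 * (-Real.log θ) / Real.log N₀) / 2 := by linarith
    have hw0 : 0 ≤ w / 2 - 1 := by linarith
    calc Real.log g * (w / 2 - 1) ≤ Real.log N₀ * ((2 / 3 * (-Real.log θ) / Real.log N₀) / 2) :=
          mul_le_mul hlg hw' hw0 hL.le
      _ = Real.log θ * (-(1 / 3)) := by field_simp
  have h5 : θ ^ (2 / 3 : ℝ) * θ ^ (-(1 / 3) : ℝ) ≤ 1 := by
    rw [← Real.rpow_add hθ0, show (2 / 3 : ℝ) + -(1 / 3) = 1 / 3 by norm_num]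
    exact Real.rpow_le_one hθ0.le hθ1.le (by norm_num)
  have hRHS : g ≤ charDegreePowSum G w := by rw [hg]; exact card_le_charDegreePowSum G hw2
  calc N ^ (w / 3) ≤ (θ * g ^ (3 / 2 : ℝ)) ^ (w / 3) := h1
    _ = θ ^ (w / 3) * (g * g ^ (w / 2 - 1)) := h2
    _ ≤ θ ^ (2 / 3 : ℝ) * (g * θ ^ (-(1 / 3) : ℝ)) := by
        apply mul_le_mul h3 (mul_le_mul_of_nonneg_left h4 hg0.le) (by positivity) (by positivity)
    _ = (θ ^ (2 / 3 : ℝ) * θ ^ (-(1 / 3) : ℝ)) * g := by ring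
    _ ≤ 1 * g := mul_le_mul_of_nonneg_right h5 hg0.le
    _ = g := one_mul g
    _ ≤ charDegreePowSum G w := hRHS

/-- `m^{a/b} ≤ g` from `m^a ≤ g^b` (`b > 0`). [folklore] -/
private theorem rpow_div_le_of_pow_le {m g a b : ℕ} (hb : 0 < b) (h : m ^ a ≤ g ^ b) :
    (m : ℝ) ^ ((a : ℝ) / b) ≤ g := by
  have hm : (0 : ℝ) ≤ m := Nat.cast_nonneg m
  have hg : (0 : ℝ) ≤ g := Nat.cast_nonneg g
  have hb0 : (0 : ℝ) < b := Nat.cast_pos.mpr hb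
  have h' : ((m : ℝ) ^ (a : ℝ)) ≤ (g : ℝ) ^ (b : ℝ) := by
    rw [Real.rpow_natCast, Real.rpow_natCast]; exact_mod_cast h
  calc (m : ℝ) ^ ((a : ℝ) / b) = ((m : ℝ) ^ (a : ℝ)) ^ ((1 : ℝ) / b) := by
        rw [← Real.rpow_mul hm]; ring_nf
    _ ≤ ((g : ℝ) ^ (b : ℝ)) ^ ((1 : ℝ) / b) :=
        Real.rpow_le_rpow (Real.rpow_nonneg hm _) h' (by positivity)
    _ = g := by
        rw [← Real.rpow_mul hg, mul_one_div_cancel hb0.ne', Real.rpow_one]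

/-- One case of the finite check: if `N² ≤ g³ < (M+1)²` and `M^{401} ≤ g^{600}` then
`N^{w/3} ≤ g` for `1 ≤ N` and `w ≤ 2 + 1/200`. [folklore] -/
private theorem rpow_le_of_table {N g M : ℕ} (hN1 : 1 ≤ N) (hN2 : N * N ≤ g ^ 3)
    (hM : g ^ 3 < (M + 1) * (M + 1)) (hpow : M ^ 401 ≤ g ^ 600) {w : ℝ} (hw : w ≤ 2 + 1 / 200) :
    (N : ℝ) ^ (w / 3) ≤ g := by
  have hNM : N ≤ M := by
    have : N * N < (M + 1) * (M + 1) := lt_of_le_of_lt hN2 hM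
    have := Nat.mul_self_lt_mul_self_iff.mp this
    omega
  have hN1' : (1 : ℝ) ≤ N := by exact_mod_cast hN1
  calc (N : ℝ) ^ (w / 3) ≤ (N : ℝ) ^ (((401 : ℕ) : ℝ) / (600 : ℕ)) :=
        Real.rpow_le_rpow_of_exponent_le hN1' (by push_cast; linarith)
    _ ≤ (M : ℝ) ^ (((401 : ℕ) : ℝ) / (600 : ℕ)) :=
        Real.rpow_le_rpow (by positivity) (by exact_mod_cast hNM) (by positivity)
    _ ≤ g := rpow_div_le_of_pow_le (by norm_num) hpow

/-- **Tiny groups** (`|G| ≤ 11`): Thm. 2.2's inequality holds on `[2, 2 + 1/200]` for every TPP triple.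
Abelian `G`: `|S||T||U| ≤ |G|` (Cohn–Umans); non-abelian `G` (so `|G| ∉ {4, 9}`): `(|S||T||U|)² ≤
|G|³` and a finite check. [cite: BlasiakCohnGrochowPrattUmans2023, Cor. 3.5 (with Cohn–Umans 2003, Lemma 3.1)] -/
theorem noCertificate_of_card_le_eleven (h11 : Fintype.card G ≤ 11) (S T U : Finset G)
    (hTPP : TripleProductProperty S T U) {w : ℝ} (hw2 : 2 ≤ w) (hw : w ≤ 2 + 1 / 200) :
    ((S.card * T.card * U.card : ℕ) : ℝ) ^ (w / 3) ≤ charDegreePowSum G w := by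
  classical
  set g : ℕ := Fintype.card G with hg
  have hg1 : 1 ≤ g := Fintype.card_pos
  have hRHS : (g : ℝ) ≤ charDegreePowSum G w := card_le_charDegreePowSum G hw2
  set N : ℕ := S.card * T.card * U.card with hN
  have hw3 : 0 < w / 3 := by linarith
  -- `N = 0`
  rcases Nat.eq_zero_or_pos N with hN0 | hNpos
  · rw [hN0, Nat.cast_zero, Real.zero_rpow hw3.ne']
    exact le_trans (by exact_mod_cast (Nat.zero_le g)) hRHS
  have hS : S.Nonempty := Finset.card_pos.mp (by
    rcases Nat.eq_zero_or_pos S.card with h | h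
    · exfalso; rw [hN, h, zero_mul, zero_mul] at hNpos; exact lt_irrefl 0 hNpos
    · exact h)
  have hT : T.Nonempty := Finset.card_pos.mp (by
    rcases Nat.eq_zero_or_pos T.card with h | h
    · exfalso; rw [hN, h, mul_zero, zero_mul] at hNpos; exact lt_irrefl 0 hNpos
    · exact h)
  have hU : U.Nonempty := Finset.card_pos.mp (by
    rcases Nat.eq_zero_or_pos U.card with h | h
    · exfalso; rw [hN, h, mul_zero] at hNpos; exact lt_irrefl 0 hNpos
    · exact h)
  by_cases hab : ∀ a b : G, a * b = b * a
  · -- abelian: `N ≤ g`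
    have hNg : N ≤ g := tripleProductProperty_card_le_of_comm hab hTPP
    have hN1 : (1 : ℝ) ≤ N := by exact_mod_cast hNpos
    calc (N : ℝ) ^ (w / 3) ≤ (N : ℝ) ^ (1 : ℝ) :=
          Real.rpow_le_rpow_of_exponent_le hN1 (by linarith)
      _ = N := Real.rpow_one _
      _ ≤ g := by exact_mod_cast hNg
      _ ≤ _ := hRHS
  · -- non-abelian: `g ≠ 4, 9`, and the finite check
    push Not at hab
    obtain ⟨a, b, hab⟩ := hab
    have hg4 : g ≠ 4 := by
      intro h4
      haveI : Fact (Nat.Prime 2) := ⟨Nat.prime_two⟩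
      have hcomm := IsPGroup.isMulCommutative_of_card_eq_prime_sq (p := 2) (G := G)
        (by rw [Nat.card_eq_fintype_card, ← hg, h4]; norm_num)
      exact hab (hcomm.is_comm.comm a b)
    have hg9 : g ≠ 9 := by
      intro h9
      haveI : Fact (Nat.Prime 3) := ⟨Nat.prime_three⟩
      have hcomm := IsPGroup.isMulCommutative_of_card_eq_prime_sq (p := 3) (G := G)
        (by rw [Nat.card_eq_fintype_card, ← hg, h9]; norm_num)
      exact hab (hcomm.is_comm.comm a b)
    have hN2 : N * N ≤ g ^ 3 := card_prod_sq_le_of_tpp G hTPP hS hT hU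
    refine le_trans ?_ hRHS
    interval_cases g
    · exact rpow_le_of_table (M := 1) hNpos hN2 (by norm_num) (by decide +kernel) hw
    · exact rpow_le_of_table (M := 2) hNpos hN2 (by norm_num) (by decide +kernel) hw
    · exact rpow_le_of_table (M := 5) hNpos hN2 (by norm_num) (by decide +kernel) hw
    · exact absurd rfl hg4
    · exact rpow_le_of_table (M := 11) hNpos hN2 (by norm_num) (by decide +kernel) hw
    · exact rpow_le_of_table (M := 14) hNpos hN2 (by norm_num) (by decide +kernel) hw
    · exact rpow_le_of_table (M := 18) hNpos hN2 (by norm_num) (by decide +kernel) hw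
    · exact rpow_le_of_table (M := 22) hNpos hN2 (by norm_num) (by decide +kernel) hw
    · exact absurd rfl hg9
    · exact rpow_le_of_table (M := 31) hNpos hN2 (by norm_num) (by decide +kernel) hw
    · exact rpow_le_of_table (M := 36) hNpos hN2 (by norm_num) (by decide +kernel) hw

end Regimes

/-! ## §5 Assembly: Cor. 3.4 for `SL(n, q)` and `PSL(n, q)` -/

section Assembly

/-- The uniform `ε` for an abstract family member: a non-abelian finite group `G` attached to
parameters `q ≥ 2`, `m ≥ 1` with `n(G) ≥ q^m/4`, `k(G) ≤ q^{2m+3}`, `|G| ≤ q^{(m+1)²}` (as `SL_{m+1}(q)`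
and `PSL_{m+1}(q)` are, given a class-number bound `k(GL_{m+1}(q)) ≤ q^{2(m+1)}`).
[cite: BlasiakCohnGrochowPrattUmans2023, Cor. 3.4 (proof)] -/
theorem exists_eps_noCertificate_family :
    ∃ ε : ℝ, 0 < ε ∧ ∀ (q m : ℕ), 2 ≤ q → 1 ≤ m →
      ∀ (G : Type) [Group G] [Fintype G], (∃ a b : G, a * b ≠ b * a) →
        (q : ℝ) ^ m / 4 ≤ secondCharDegree G →
        (Nat.card (ConjClasses G) : ℝ) ≤ (q : ℝ) ^ (2 * m + 3) →
        (Fintype.card G : ℝ) ≤ (q : ℝ) ^ ((m + 1) * (m + 1)) →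
        ∀ (S T U : Finset G), TripleProductProperty S T U →
          ((S.card * T.card * U.card : ℕ) : ℝ) ^ ((2 + ε) / 3) ≤ charDegreePowSum G (2 + ε) := by
  classical
  obtain ⟨ε₂, hε₂, N₀, hN₀⟩ :=
    exists_eps_noCertificate_of_secondCharDegree_ge (c := 1 / 4) (δ := 4 / 25) (by norm_num) (by norm_num)
  obtain ⟨ε₃, hε₃, hsmall⟩ := exists_eps_noCertificate_of_card_le N₀
  set ε : ℝ := min (1 / 200) (min ε₂ ε₃) with hεdef
  have hε0 : 0 < ε := lt_min (by norm_num) (lt_min hε₂ hε₃)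
  have hε200 : ε ≤ 1 / 200 := min_le_left _ _
  have hεε₂ : ε ≤ ε₂ := (min_le_right _ _).trans (min_le_left _ _)
  have hεε₃ : ε ≤ ε₃ := (min_le_right _ _).trans (min_le_right _ _)
  refine ⟨ε, hε0, ?_⟩
  intro q m hq hm G _ _ hG hν hk hcard S T U hTPP
  have hq1 : (1 : ℝ) ≤ q := by exact_mod_cast (by omega : 1 ≤ q)
  have hq2 : (2 : ℝ) ≤ q := by exact_mod_cast hq
  have hq0 : (0 : ℝ) < q := by linarith
  have hw2 : (2 : ℝ) ≤ 2 + ε := by linarith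
  by_cases hm5 : 5 ≤ m
  · -- large rank
    have hν4 : 4 ≤ secondCharDegree G := by
      have h16 : (16 : ℝ) ≤ (q : ℝ) ^ m := by
        calc (16 : ℝ) = 2 ^ 4 := by norm_num
          _ ≤ (q : ℝ) ^ 4 := pow_le_pow_left₀ (by norm_num) hq2 4
          _ ≤ (q : ℝ) ^ m := pow_le_pow_right₀ hq1 (by omega)
      have : (4 : ℝ) ≤ secondCharDegree G := by linarith
      exact_mod_cast this
    refine noCertificate_of_few_classes G hG hν4 ?_ S T U hTPP hw2 le_rfl
    -- `k^ε ≤ k^{1/20} ≤ q^{(2m+3)/20} ≤ q^{2m/3}/2^{8/3} ≤ (ν/4)^{2/3}`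
    set k : ℝ := ((Nat.card (ConjClasses G) : ℕ) : ℝ) with hkdef
    set ν : ℝ := ((secondCharDegree G : ℕ) : ℝ) with hνdef
    have hk1 : (1 : ℝ) ≤ k := by
      rw [hkdef]; have : 0 < Nat.card (ConjClasses G) := Nat.card_pos
      exact_mod_cast this
    have hk0 : 0 < k := by linarith
    have hqm : (q : ℝ) ^ m / 4 ≤ ν := hν
    have hν0 : 0 < ν := by
      have : (0 : ℝ) < (q : ℝ) ^ m / 4 := by positivity
      linarith
    have h1 : k ^ ε ≤ k ^ (1 / 20 : ℝ) := Real.rpow_le_rpow_of_exponent_le hk1 (by linarith)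
    have h2 : k ^ (1 / 20 : ℝ) ≤ ((q : ℝ) ^ (2 * m + 3)) ^ (1 / 20 : ℝ) :=
      Real.rpow_le_rpow hk0.le hk (by norm_num)
    have h3 : ((q : ℝ) ^ (2 * m + 3)) ^ (1 / 20 : ℝ) = (q : ℝ) ^ (((2 * m + 3 : ℕ) : ℝ) / 20) := by
      rw [← Real.rpow_natCast, ← Real.rpow_mul hq0.le]; ring_nf
    -- the exponent gap
    have hexp : (8 / 3 : ℝ) ≤ (2 * (m : ℝ)) / 3 - ((2 * m + 3 : ℕ) : ℝ) / 20 := by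
      have hm' : (5 : ℝ) ≤ m := by exact_mod_cast hm5
      push_cast
      linarith
    have h4 : (2 : ℝ) ^ (8 / 3 : ℝ) ≤ (q : ℝ) ^ ((2 * (m : ℝ)) / 3 - ((2 * m + 3 : ℕ) : ℝ) / 20) :=
      calc (2 : ℝ) ^ (8 / 3 : ℝ) ≤ (2 : ℝ) ^ ((2 * (m : ℝ)) / 3 - ((2 * m + 3 : ℕ) : ℝ) / 20) :=
            Real.rpow_le_rpow_of_exponent_le (by norm_num) hexp
        _ ≤ (q : ℝ) ^ ((2 * (m : ℝ)) / 3 - ((2 * m + 3 : ℕ) : ℝ) / 20) :=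
            Real.rpow_le_rpow (by norm_num) hq2 (by linarith)
    -- `(ν/4)^{2/3} ≥ (q^m/16)^{2/3} = q^{2m/3} / 2^{8/3}`
    have h5 : ((q : ℝ) ^ m / 16) ^ (2 / 3 : ℝ) ≤ (ν / 4) ^ (2 / 3 : ℝ) :=
      Real.rpow_le_rpow (by positivity) (by linarith) (by norm_num)
    have h6 : ((q : ℝ) ^ m / 16) ^ (2 / 3 : ℝ) = (q : ℝ) ^ ((2 * (m : ℝ)) / 3) / (2 : ℝ) ^ (8 / 3 : ℝ) := by
      rw [Real.div_rpow (by positivity) (by norm_num), ← Real.rpow_natCast, ← Real.rpow_mul hq0.le,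
        show (16 : ℝ) = 2 ^ (4 : ℝ) by norm_num, ← Real.rpow_mul (by norm_num)]
      ring_nf
    have h28 : 0 < (2 : ℝ) ^ (8 / 3 : ℝ) := Real.rpow_pos_of_pos two_pos _
    have h7 : (q : ℝ) ^ (((2 * m + 3 : ℕ) : ℝ) / 20) ≤
        (q : ℝ) ^ ((2 * (m : ℝ)) / 3) / (2 : ℝ) ^ (8 / 3 : ℝ) := by
      rw [le_div_iff₀ h28]
      have e : (q : ℝ) ^ ((2 * (m : ℝ)) / 3) =
          (q : ℝ) ^ (((2 * m + 3 : ℕ) : ℝ) / 20) * (q : ℝ) ^ ((2 * (m : ℝ)) / 3 - ((2 * m + 3 : ℕ) : ℝ) / 20) := by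
        rw [← Real.rpow_add hq0]; ring_nf
      rw [e]
      exact mul_le_mul_of_nonneg_left h4 (by positivity)
    calc k ^ ε ≤ k ^ (1 / 20 : ℝ) := h1
      _ ≤ ((q : ℝ) ^ (2 * m + 3)) ^ (1 / 20 : ℝ) := h2
      _ = (q : ℝ) ^ (((2 * m + 3 : ℕ) : ℝ) / 20) := h3
      _ ≤ (q : ℝ) ^ ((2 * (m : ℝ)) / 3) / (2 : ℝ) ^ (8 / 3 : ℝ) := h7
      _ = ((q : ℝ) ^ m / 16) ^ (2 / 3 : ℝ) := h6.symm
      _ ≤ (ν / 4) ^ (2 / 3 : ℝ) := h5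
  · push Not at hm5
    by_cases hbig : N₀ ≤ Fintype.card G
    · -- bounded rank, large group: Cor. 3.3 with `c = 1/4`, `δ = 4/25`
      have hmν : (1 / 4 : ℝ) * (Fintype.card G : ℝ) ^ (4 / 25 : ℝ) ≤ secondCharDegree G := by
        have hG0 : (0 : ℝ) ≤ Fintype.card G := Nat.cast_nonneg _
        have h1 : (Fintype.card G : ℝ) ^ (4 / 25 : ℝ) ≤ ((q : ℝ) ^ ((m + 1) * (m + 1))) ^ (4 / 25 : ℝ) :=
          Real.rpow_le_rpow hG0 hcard (by norm_num)
        have h2 : ((q : ℝ) ^ ((m + 1) * (m + 1))) ^ (4 / 25 : ℝ) =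
            (q : ℝ) ^ ((((m + 1) * (m + 1) : ℕ) : ℝ) * (4 / 25)) := by
          rw [← Real.rpow_natCast, ← Real.rpow_mul hq0.le]
        have hexp : ((((m + 1) * (m + 1) : ℕ) : ℝ) * (4 / 25)) ≤ (m : ℝ) := by
          interval_cases m <;> norm_num
        have h3 : (q : ℝ) ^ ((((m + 1) * (m + 1) : ℕ) : ℝ) * (4 / 25)) ≤ (q : ℝ) ^ (m : ℝ) :=
          Real.rpow_le_rpow_of_exponent_le hq1 hexp
        rw [Real.rpow_natCast] at h3
        linarith [h1, h2, h3, hν]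
      exact hN₀ G hG hbig hmν S T U hTPP (2 + ε) hw2 (by linarith)
    · push Not at hbig
      by_cases h12 : 12 ≤ Fintype.card G
      · exact hsmall G h12 hbig.le S T U hTPP (2 + ε) hw2 (by linarith)
      · push Not at h12
        exact noCertificate_of_card_le_eleven G (by omega) S T U hTPP hw2 (by linarith)

variable {F : Type} [Field F] [Fintype F] [DecidableEq F]

/-- **BCGPU 2023, Cor. 3.4 for `SL(n, q)` and `PSL(n, q)`, from a class-number bound
`k(GL_n(q)) ≤ q^{2n}`** (e.g. the named fact `FulmanGuralnick2012_prop35`, `k(GL_n(q)) ≤ qⁿ`):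
the named fact `BCGPU2023_cor34_typeA` follows. [cite: BlasiakCohnGrochowPrattUmans2023, Cor. 3.4] -/
theorem BCGPU2023_cor34_typeA_of_classNumber_GL
    (hk : ∀ (F : Type) [Field F] [Fintype F] (n : ℕ),
      Nat.card (ConjClasses (GL (Fin n) F)) ≤ Fintype.card F ^ (2 * n)) :
    BCGPU2023_cor34_typeA := by
  classical
  obtain ⟨ε, hε, hfam⟩ := exists_eps_noCertificate_family
  refine ⟨ε, hε, ?_⟩
  intro F _ _ n hn
  obtain ⟨m, rfl⟩ : ∃ m, n = m + 1 := ⟨n - 1, by omega⟩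
  have hm : 1 ≤ m := by omega
  set q : ℕ := Fintype.card F with hq
  have hq2 : 2 ≤ q := Fintype.one_lt_card
  have hq1 : 1 ≤ q := by omega
  have hqR : (1 : ℝ) ≤ q := by exact_mod_cast hq1
  -- the class-number bound for `SL` and `PSL`
  have hkSLnat : Nat.card (ConjClasses (SpecialLinearGroup (Fin (m + 1)) F)) ≤ q ^ (2 * m + 3) := by
    calc Nat.card (ConjClasses (SpecialLinearGroup (Fin (m + 1)) F))
        ≤ (q - 1) * Nat.card (ConjClasses (GL (Fin (m + 1)) F)) := card_conjClasses_SL_le (m + 1) F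
      _ ≤ q * q ^ (2 * (m + 1)) := Nat.mul_le_mul (Nat.sub_le q 1) (hk F (m + 1))
      _ = q ^ (2 * m + 3) := by ring
  have hkSL : (Nat.card (ConjClasses (SpecialLinearGroup (Fin (m + 1)) F)) : ℝ) ≤ (q : ℝ) ^ (2 * m + 3) := by
    exact_mod_cast hkSLnat
  have hkPSL : (Nat.card (ConjClasses (Matrix.ProjectiveSpecialLinearGroup (Fin (m + 1)) F)) : ℝ) ≤
      (q : ℝ) ^ (2 * m + 3) := by
    exact_mod_cast (card_conjClasses_PSL_le (m + 1) F).trans hkSLnat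
  have hcSL : (Fintype.card (SpecialLinearGroup (Fin (m + 1)) F) : ℝ) ≤ (q : ℝ) ^ ((m + 1) * (m + 1)) := by
    exact_mod_cast card_SL_le (F := F) (m := m)
  have hcPSL : (Fintype.card (Matrix.ProjectiveSpecialLinearGroup (Fin (m + 1)) F) : ℝ) ≤
      (q : ℝ) ^ ((m + 1) * (m + 1)) := by
    exact_mod_cast (card_PSL_le (F := F) (m := m)).trans (card_SL_le (F := F) (m := m))
  constructor
  · intro S T U hTPP
    exact hfam q m hq2 hm _ (exists_not_commute_SL hm) (secondCharDegree_SL_ge hm) hkSL hcSL S T U hTPP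
  · intro S T U hTPP
    exact hfam q m hq2 hm _ (exists_not_commute_PSL hm) (secondCharDegree_PSL_ge hm) hkPSL hcPSL
      S T U hTPP

/-- **`FulmanGuralnick2012_prop35 → BCGPU2023_cor34_typeA`**: the class number of `GL_n(q)` is at most
`qⁿ ≤ q^{2n}` (Maslen–Rockmore / Fulman–Guralnick Prop. 3.5), so the previous theorem applies.
[cite: BlasiakCohnGrochowPrattUmans2023, Cor. 3.4] [cite: FulmanGuralnick2012, Prop. 3.5(2)] -/
theorem BCGPU2023_cor34_typeA_of_FulmanGuralnick (h : FulmanGuralnick2012_prop35) :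
    BCGPU2023_cor34_typeA := by
  refine BCGPU2023_cor34_typeA_of_classNumber_GL fun F _ _ n => ?_
  calc Nat.card (ConjClasses (GL (Fin n) F)) ≤ Fintype.card F ^ n := h.classNumber_GL_le F n
    _ ≤ Fintype.card F ^ (2 * n) :=
        Nat.pow_le_pow_right Fintype.card_pos (by omega)

/-- **BCGPU 2023, Cor. 3.4 for the families `SL(n, q)` and `PSL(n, q)` — discharge of the named fact
`BCGPU2023_cor34_typeA`**: «the group-theoretic approach cannot prove `ω = 2` using TPP constructions
in any family of finite simple groups of Lie type» [here: `SL_n(𝔽_q)`, `PSL_n(𝔽_q)`, all `n ≥ 2`, all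
finite fields, one absolute `ε > 0`], unconditionally: the class-number input is the elementary
`k(GL_n(q)) ≤ q^{2n}` (`card_conjClasses_GL_le_pow`). [cite: BlasiakCohnGrochowPrattUmans2023, Cor. 3.4] -/
theorem BCGPU2023_cor34_typeA_holds : BCGPU2023_cor34_typeA :=
  BCGPU2023_cor34_typeA_of_classNumber_GL fun F _ _ n => card_conjClasses_GL_le_pow F n

end Assembly


end Literature.Barriers.MatrixMultiplication

end
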